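import Literature.Probability.RandomPlanarGeometry.HexSAWStripWidthThreeHatSpectralCertificate
import Literature.Analysis.Asymptotics.LinearRecurrenceDeflationGeneral
import HarnessLib

/-!
# The width-three strip: a CONVERGENCE CRITERION for the hat bridge sums — the explicit order-`24` annihilator
# `τ(λ) = λ(λ³ − q₃)⁴S₁₁(λ; y₃)` forces GEOMETRIC convergence of every `D̂(n)_{ab}` (module «WIDTH-THREE HAT CONVERGENCE CRITERION»)

Topic `Literature/Probability/RandomPlanarGeometry` (data: the width-three critical fugacity `y₃ = stripYT 3` («WIDTH-THREE-CRITICAL», window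
`W3.stripYT_three_bounds : 2.892 < y₃ < 2.893`), `x_c = hexCriticalFugacity` (`xc_sq_eq_half`), the hat bridge sums `hatD 3 y n` of «WIDTH-THREE HAT RECURSION»
`HexSAWStripWidthThreeHatRecursion.lean` (order-four matrix recursion `hatD_three_rec`, symbol `P(λ)`), «WIDTH-THREE HAT SPECTRAL CERTIFICATE»
`HexSAWStripWidthThreeHatSpectralCertificate.lean` (`rTenCoeff`, `rTenEvalC`, `sElevenOne`, ★ `rTen_root_norm_lt`, ★ `sElevenOne_stripYT_three`), and the abstract
convergence theorem `Literature.Analysis.exists_norm_sub_le_of_linearRecurrence_one` of «LINEAR RECURRENCE DEFLATION — GENERAL ORDER»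
`Literature/Analysis/Asymptotics/LinearRecurrenceDeflationGeneral.lean`).  Lane «pcv-sawmu» (CriticalPhenomena venture), a-p2 g28 — the assembly car of
`HOME/pub-sawmu-a-p2/g28/DESIGN-W3-CONVERGENCE.md` (routes A/C).  KIT FACTS OF RECORD (sympy over `ℚ(√2)[x, y, q, λ]`, jobs j301570 / j303124 / j303970 / j303997, scripts
`HOME/pub-sawmu-a-p2/g28/hat3/kit/{charpoly,gen_annih3,factor_id,factor_coeff}.py`): `charpoly(𝔾₃(y)) = λ(λ³ − x⁶y)⁴S₁₁(λ; y)`; the hat symbol `P(λ) = λ⁴ − G λ³ − x⁶yλ(1 + E′) + x⁶yG`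
has `det P(λ) = Σ_{r ≤ 24} t_r λ^r` (`t₂₄ = 1`, 68 terms) and `adj P · P = det P · 1`, whence the hat sums satisfy `Σ_r t_r D̂(n+1+r) = 0`; and `b₁₀ · det P(λ) = λ(λ³ − q)⁴S₁₁(λ; y)`
at `q = x⁶y`, `2x² = 2 − √2` (`x = x_c`; `b₁₀ = −2704 − 1912√2`; remainder `0`, j303970).  THIS MODULE types the `25` coefficients `τ_r = b₁₀t_r` of `τ(λ) := λ(λ³ − q)⁴S₁₁(λ; y)` EXACTLY
(§1, `210` monomials in `y, √2, q`), proves the generating identity `Σ_r τ_r z^r = z(z³ − q)⁴((z − 1)R₁₀(z; y) + S₁₁(1; y))` by `ring`, builds the MONIC factor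
`Q = X(X³ − q₃)⁴R₁₀/b₁₀` of degree `23` with all roots in the closed disc of radius `0.97` (§2: `0`, the cube roots of `q₃ ≤ 0.08`, and the certificate's `R₁₀`-roots),
factors `τ = b₁₀(X − 1)Q` at `y = y₃` using `S₁₁(1; y₃) = 0` (§3), and concludes (§4) the ★★★ CONVERGENCE CRITERION: IF the hat sums satisfy the scalar recurrence
`Σ_{r ≤ 24} τ_r D̂(n+1+r)_{ab} = 0` (the annihilator — the one remaining car, route A), THEN `|D̂(n+1)_{ab} − A_{ab}| ≤ C(n+1)^{23}(0.97)^n` for a real matrix `A` and a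
constant `C`.  Source of the frame: R. P. Stanley, EC1 (2012) §4.1 Theorem 4.1.1 (iii) (rational generating functions ⇔ linear recurrences ⇔ exponential-polynomial
closed forms); W. Feller (1968) XIII.3 (renewal limits).  Nothing below is printed.

## What is proved (namespace `Literature.Probability.RandomPlanarGeometry.SAW.HV.W3`; `y₃ = stripYT 3`, `q₃ = x_c⁶y₃`)

* §1 `tauThree0 … tauThree24`, `tauThree y q : ℕ → ℝ` (the `25` coefficient polynomials, exact), ★ `tauThree_eval` :
  `Σ_{r<25} τ_r(y,q) z^r = z(z³ − q)⁴((z − 1)·rTenEvalC y z + sElevenOne y)` for all real `y, q` and complex `z` (pure `ring` — the coefficient table IS the expansion).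
* §2 `bTenThree = −2704 − 1912√2 < 0` (`= rTenCoeff y 10`), `rTenMonicPoly y` (monic, degree `10`, `b₁₀ · eval = rTenEvalC`), `qMonicThree = X(X³ − C q₃)⁴ · rTenMonicPoly y₃`
  (★ `qMonicThree_monic` : monic of degree `23`; `qMonicThree_eval`), `qThree_le : q₃ ≤ 8/100`, ★★ `qMonicThree_root_norm_le : Q(z) = 0 → ‖z‖ ≤ 97/100`.
* §3 `tauPolyThree = Σ_r C(τ_r(y₃, q₃)) X^r`, `tauPolyThree_coeff`, ★★ `tauPolyThree_eq : tauPolyThree = C b₁₀ · ((X − C 1) · qMonicThree)` (via `sElevenOne_stripYT_three`).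
* §4 `sum_coeff_X_sub_one_mul` (bookkeeping `Σ_j Q_j(d_{n+1+j} − d_{n+j}) = Σ_r ((X−1)Q)_r d_{n+r}`), ★★★ **`hatD_three_geometric_of_annihilator`** (the criterion above).

Label: LANE THEOREM (own result of lane «pcv-sawmu», a-p2 g28, 2026-08-28; not in print), CONDITIONAL exactly as stated: the hypothesis `hann` (the annihilator
identity for `hatD 3 (stripYT 3)`) is NOT proved here — it is the adjugate identity `adj P · P = det P · 1` pushed through `hatD_three_rec` (kit-verified symbolically,
j303124/j303997; its Lean typing is the heir's route A, see DESIGN §6).  NOT claimed: the value of the limit matrix `A`, the sharp rate `0.4523`, anything about `σ₃²`.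
-/

noncomputable section

open Finset Filter Topology Polynomial Literature.Probability.LatticeModels Literature.Probability.Percolation

namespace Literature.Probability.RandomPlanarGeometry.SAW

namespace HV

namespace W3

/-! ## §1 The annihilating polynomial `τ(λ) = λ(λ³ − q)⁴·S₁₁(λ; y) = Σ_{r ≤ 24} τ_r λ^r` — explicit coefficients -/

/-- `τ_0(y, q)`: the coefficient of `λ^0` in `τ(λ) = λ(λ³ − q)⁴S₁₁(λ; y)` (kit `factor_coeff.py`, job j303997). [cite: Stanley2012EC1, §4.1 Theorem 4.1.1; lane «pcv-sawmu» a-p2 g28 — own computation] -/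
def tauThree0 (_y _q : ℝ) : ℝ := 0

/-- `τ_1(y, q)`: the coefficient of `λ^1` in `τ(λ) = λ(λ³ − q)⁴S₁₁(λ; y)` (kit `factor_coeff.py`, job j303997). [cite: Stanley2012EC1, §4.1 Theorem 4.1.1; lane «pcv-sawmu» a-p2 g28 — own computation] -/
def tauThree1 (y q : ℝ) : ℝ := (17 / 4 : ℝ) * y ^ 3 * q ^ 4 + (-3 : ℝ) * y ^ 3 * Real.sqrt 2 * q ^ 4

/-- `τ_2(y, q)`: the coefficient of `λ^2` in `τ(λ) = λ(λ³ − q)⁴S₁₁(λ; y)` (kit `factor_coeff.py`, job j303997). [cite: Stanley2012EC1, §4.1 Theorem 4.1.1; lane «pcv-sawmu» a-p2 g28 — own computation] -/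
def tauThree2 (y q : ℝ) : ℝ := (-5 : ℝ) * y ^ 3 * q ^ 4 + (-5 / 2 : ℝ) * y ^ 2 * q ^ 4 + (7 / 2 : ℝ) * y ^ 3 * Real.sqrt 2 * q ^ 4 + (7 / 4 : ℝ) * y ^ 2 * Real.sqrt 2 * q ^ 4

/-- `τ_3(y, q)`: the coefficient of `λ^3` in `τ(λ) = λ(λ³ − q)⁴S₁₁(λ; y)` (kit `factor_coeff.py`, job j303997). [cite: Stanley2012EC1, §4.1 Theorem 4.1.1; lane «pcv-sawmu» a-p2 g28 — own computation] -/
def tauThree3 (y q : ℝ) : ℝ := (3 : ℝ) * y ^ 3 * q ^ 4 + (9 / 2 : ℝ) * y ^ 2 * q ^ 4 + (-3 : ℝ) * y ^ 2 * Real.sqrt 2 * q ^ 4 + (-2 : ℝ) * y ^ 3 * Real.sqrt 2 * q ^ 4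

/-- `τ_4(y, q)`: the coefficient of `λ^4` in `τ(λ) = λ(λ³ − q)⁴S₁₁(λ; y)` (kit `factor_coeff.py`, job j303997). [cite: Stanley2012EC1, §4.1 Theorem 4.1.1; lane «pcv-sawmu» a-p2 g28 — own computation] -/
def tauThree4 (y q : ℝ) : ℝ := (-17 : ℝ) * y ^ 3 * q ^ 3 + (-6 : ℝ) * y ^ 2 * q ^ 4 + (-2 : ℝ) * y ^ 3 * q ^ 4 + (1 : ℝ) * y ^ 3 * Real.sqrt 2 * q ^ 4 + (3 : ℝ) * y ^ 2 * Real.sqrt 2 * q ^ 4 + (12 : ℝ) * y ^ 3 * Real.sqrt 2 * q ^ 3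

/-- `τ_5(y, q)`: the coefficient of `λ^5` in `τ(λ) = λ(λ³ − q)⁴S₁₁(λ; y)` (kit `factor_coeff.py`, job j303997). [cite: Stanley2012EC1, §4.1 Theorem 4.1.1; lane «pcv-sawmu» a-p2 g28 — own computation] -/
def tauThree5 (y q : ℝ) : ℝ := (1 : ℝ) * y ^ 3 * q ^ 4 + (7 : ℝ) * y ^ 2 * q ^ 4 + (10 : ℝ) * y ^ 2 * q ^ 3 + (20 : ℝ) * y ^ 3 * q ^ 3 + (-14 : ℝ) * y ^ 3 * Real.sqrt 2 * q ^ 3 + (-7 : ℝ) * y ^ 2 * Real.sqrt 2 * q ^ 3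

/-- `τ_6(y, q)`: the coefficient of `λ^6` in `τ(λ) = λ(λ³ − q)⁴S₁₁(λ; y)` (kit `factor_coeff.py`, job j303997). [cite: Stanley2012EC1, §4.1 Theorem 4.1.1; lane «pcv-sawmu» a-p2 g28 — own computation] -/
def tauThree6 (y q : ℝ) : ℝ := (-18 : ℝ) * y ^ 2 * q ^ 3 + (-12 : ℝ) * y ^ 3 * q ^ 3 + (-10 : ℝ) * y ^ 2 * q ^ 4 + (-4 : ℝ) * y * q ^ 4 + (-5 : ℝ) * y ^ 2 * Real.sqrt 2 * q ^ 4 + (-2 : ℝ) * y * Real.sqrt 2 * q ^ 4 + (8 : ℝ) * y ^ 3 * Real.sqrt 2 * q ^ 3 + (12 : ℝ) * y ^ 2 * Real.sqrt 2 * q ^ 3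

/-- `τ_7(y, q)`: the coefficient of `λ^7` in `τ(λ) = λ(λ³ − q)⁴S₁₁(λ; y)` (kit `factor_coeff.py`, job j303997). [cite: Stanley2012EC1, §4.1 Theorem 4.1.1; lane «pcv-sawmu» a-p2 g28 — own computation] -/
def tauThree7 (y q : ℝ) : ℝ := (8 : ℝ) * y ^ 3 * q ^ 3 + (24 : ℝ) * y ^ 2 * q ^ 3 + (24 : ℝ) * y ^ 2 * q ^ 4 + (30 : ℝ) * y * q ^ 4 + (51 / 2 : ℝ) * y ^ 3 * q ^ 2 + (-18 : ℝ) * y ^ 3 * Real.sqrt 2 * q ^ 2 + (-12 : ℝ) * y ^ 2 * Real.sqrt 2 * q ^ 3 + (-4 : ℝ) * y ^ 3 * Real.sqrt 2 * q ^ 3 + (16 : ℝ) * y ^ 2 * Real.sqrt 2 * q ^ 4 + (20 : ℝ) * y * Real.sqrt 2 * q ^ 4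

/-- `τ_8(y, q)`: the coefficient of `λ^8` in `τ(λ) = λ(λ³ − q)⁴S₁₁(λ; y)` (kit `factor_coeff.py`, job j303997). [cite: Stanley2012EC1, §4.1 Theorem 4.1.1; lane «pcv-sawmu» a-p2 g28 — own computation] -/
def tauThree8 (y q : ℝ) : ℝ := (-120 : ℝ) * y * q ^ 4 + (-40 : ℝ) * y ^ 2 * q ^ 4 + (-30 : ℝ) * y ^ 3 * q ^ 2 + (-28 : ℝ) * y ^ 2 * q ^ 3 + (-15 : ℝ) * y ^ 2 * q ^ 2 + (-4 : ℝ) * y ^ 3 * q ^ 3 + (-84 : ℝ) * y * Real.sqrt 2 * q ^ 4 + (-28 : ℝ) * y ^ 2 * Real.sqrt 2 * q ^ 4 + (21 : ℝ) * y ^ 3 * Real.sqrt 2 * q ^ 2 + (21 / 2 : ℝ) * y ^ 2 * Real.sqrt 2 * q ^ 2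

/-- `τ_9(y, q)`: the coefficient of `λ^9` in `τ(λ) = λ(λ³ − q)⁴S₁₁(λ; y)` (kit `factor_coeff.py`, job j303997). [cite: Stanley2012EC1, §4.1 Theorem 4.1.1; lane «pcv-sawmu» a-p2 g28 — own computation] -/
def tauThree9 (y q : ℝ) : ℝ := (68 : ℝ) * q ^ 4 + (16 : ℝ) * y * q ^ 3 + (18 : ℝ) * y ^ 3 * q ^ 2 + (27 : ℝ) * y ^ 2 * q ^ 2 + (40 : ℝ) * y ^ 2 * q ^ 3 + (48 : ℝ) * Real.sqrt 2 * q ^ 4 + (272 : ℝ) * y * q ^ 4 + (-18 : ℝ) * y ^ 2 * Real.sqrt 2 * q ^ 2 + (-12 : ℝ) * y ^ 3 * Real.sqrt 2 * q ^ 2 + (8 : ℝ) * y * Real.sqrt 2 * q ^ 3 + (20 : ℝ) * y ^ 2 * Real.sqrt 2 * q ^ 3 + (192 : ℝ) * y * Real.sqrt 2 * q ^ 4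

/-- `τ_10(y, q)`: the coefficient of `λ^10` in `τ(λ) = λ(λ³ − q)⁴S₁₁(λ; y)` (kit `factor_coeff.py`, job j303997). [cite: Stanley2012EC1, §4.1 Theorem 4.1.1; lane «pcv-sawmu» a-p2 g28 — own computation] -/
def tauThree10 (y q : ℝ) : ℝ := (-232 : ℝ) * q ^ 4 + (-464 : ℝ) * y * q ^ 4 + (-164 : ℝ) * Real.sqrt 2 * q ^ 4 + (-120 : ℝ) * y * q ^ 3 + (-96 : ℝ) * y ^ 2 * q ^ 3 + (-36 : ℝ) * y ^ 2 * q ^ 2 + (-17 : ℝ) * y ^ 3 * q + (-12 : ℝ) * y ^ 3 * q ^ 2 + (-328 : ℝ) * y * Real.sqrt 2 * q ^ 4 + (-80 : ℝ) * y * Real.sqrt 2 * q ^ 3 + (-64 : ℝ) * y ^ 2 * Real.sqrt 2 * q ^ 3 + (6 : ℝ) * y ^ 3 * Real.sqrt 2 * q ^ 2 + (12 : ℝ) * y ^ 3 * Real.sqrt 2 * q + (18 : ℝ) * y ^ 2 * Real.sqrt 2 * q ^ 2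

/-- `τ_11(y, q)`: the coefficient of `λ^11` in `τ(λ) = λ(λ³ − q)⁴S₁₁(λ; y)` (kit `factor_coeff.py`, job j303997). [cite: Stanley2012EC1, §4.1 Theorem 4.1.1; lane «pcv-sawmu» a-p2 g28 — own computation] -/
def tauThree11 (y q : ℝ) : ℝ := (1584 : ℝ) * q ^ 4 + (6 : ℝ) * y ^ 3 * q ^ 2 + (10 : ℝ) * y ^ 2 * q + (20 : ℝ) * y ^ 3 * q + (42 : ℝ) * y ^ 2 * q ^ 2 + (160 : ℝ) * y ^ 2 * q ^ 3 + (480 : ℝ) * y * q ^ 3 + (792 : ℝ) * y * q ^ 4 + (1120 : ℝ) * Real.sqrt 2 * q ^ 4 + (-14 : ℝ) * y ^ 3 * Real.sqrt 2 * q + (-7 : ℝ) * y ^ 2 * Real.sqrt 2 * q + (112 : ℝ) * y ^ 2 * Real.sqrt 2 * q ^ 3 + (336 : ℝ) * y * Real.sqrt 2 * q ^ 3 + (560 : ℝ) * y * Real.sqrt 2 * q ^ 4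

/-- `τ_12(y, q)`: the coefficient of `λ^12` in `τ(λ) = λ(λ³ − q)⁴S₁₁(λ; y)` (kit `factor_coeff.py`, job j303997). [cite: Stanley2012EC1, §4.1 Theorem 4.1.1; lane «pcv-sawmu» a-p2 g28 — own computation] -/
def tauThree12 (y q : ℝ) : ℝ := (-2704 : ℝ) * q ^ 4 + (-272 : ℝ) * q ^ 3 + (-1912 : ℝ) * Real.sqrt 2 * q ^ 4 + (-1088 : ℝ) * y * q ^ 3 + (-192 : ℝ) * Real.sqrt 2 * q ^ 3 + (-60 : ℝ) * y ^ 2 * q ^ 2 + (-24 : ℝ) * y * q ^ 2 + (-18 : ℝ) * y ^ 2 * q + (-12 : ℝ) * y ^ 3 * q + (-768 : ℝ) * y * Real.sqrt 2 * q ^ 3 + (-30 : ℝ) * y ^ 2 * Real.sqrt 2 * q ^ 2 + (-12 : ℝ) * y * Real.sqrt 2 * q ^ 2 + (8 : ℝ) * y ^ 3 * Real.sqrt 2 * q + (12 : ℝ) * y ^ 2 * Real.sqrt 2 * q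

/-- `τ_13(y, q)`: the coefficient of `λ^13` in `τ(λ) = λ(λ³ − q)⁴S₁₁(λ; y)` (kit `factor_coeff.py`, job j303997). [cite: Stanley2012EC1, §4.1 Theorem 4.1.1; lane «pcv-sawmu» a-p2 g28 — own computation] -/
def tauThree13 (y q : ℝ) : ℝ := (928 : ℝ) * q ^ 3 + (17 / 4 : ℝ) * y ^ 3 + (-3 : ℝ) * y ^ 3 * Real.sqrt 2 + (8 : ℝ) * y ^ 3 * q + (24 : ℝ) * y ^ 2 * q + (144 : ℝ) * y ^ 2 * q ^ 2 + (180 : ℝ) * y * q ^ 2 + (656 : ℝ) * Real.sqrt 2 * q ^ 3 + (1856 : ℝ) * y * q ^ 3 + (-12 : ℝ) * y ^ 2 * Real.sqrt 2 * q + (-4 : ℝ) * y ^ 3 * Real.sqrt 2 * q + (96 : ℝ) * y ^ 2 * Real.sqrt 2 * q ^ 2 + (120 : ℝ) * y * Real.sqrt 2 * q ^ 2 + (1312 : ℝ) * y * Real.sqrt 2 * q ^ 3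

/-- `τ_14(y, q)`: the coefficient of `λ^14` in `τ(λ) = λ(λ³ − q)⁴S₁₁(λ; y)` (kit `factor_coeff.py`, job j303997). [cite: Stanley2012EC1, §4.1 Theorem 4.1.1; lane «pcv-sawmu» a-p2 g28 — own computation] -/
def tauThree14 (y q : ℝ) : ℝ := (-6336 : ℝ) * q ^ 3 + (-5 : ℝ) * y ^ 3 + (-5 / 2 : ℝ) * y ^ 2 + (-4480 : ℝ) * Real.sqrt 2 * q ^ 3 + (-3168 : ℝ) * y * q ^ 3 + (-720 : ℝ) * y * q ^ 2 + (-240 : ℝ) * y ^ 2 * q ^ 2 + (-28 : ℝ) * y ^ 2 * q + (-4 : ℝ) * y ^ 3 * q + (7 / 2 : ℝ) * y ^ 3 * Real.sqrt 2 + (7 / 4 : ℝ) * y ^ 2 * Real.sqrt 2 + (-2240 : ℝ) * y * Real.sqrt 2 * q ^ 3 + (-504 : ℝ) * y * Real.sqrt 2 * q ^ 2 + (-168 : ℝ) * y ^ 2 * Real.sqrt 2 * q ^ 2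

/-- `τ_15(y, q)`: the coefficient of `λ^15` in `τ(λ) = λ(λ³ − q)⁴S₁₁(λ; y)` (kit `factor_coeff.py`, job j303997). [cite: Stanley2012EC1, §4.1 Theorem 4.1.1; lane «pcv-sawmu» a-p2 g28 — own computation] -/
def tauThree15 (y q : ℝ) : ℝ := (3 : ℝ) * y ^ 3 + (408 : ℝ) * q ^ 2 + (10816 : ℝ) * q ^ 3 + (9 / 2 : ℝ) * y ^ 2 + (-3 : ℝ) * y ^ 2 * Real.sqrt 2 + (-2 : ℝ) * y ^ 3 * Real.sqrt 2 + (16 : ℝ) * y * q + (40 : ℝ) * y ^ 2 * q + (288 : ℝ) * Real.sqrt 2 * q ^ 2 + (1632 : ℝ) * y * q ^ 2 + (7648 : ℝ) * Real.sqrt 2 * q ^ 3 + (8 : ℝ) * y * Real.sqrt 2 * q + (20 : ℝ) * y ^ 2 * Real.sqrt 2 * q + (1152 : ℝ) * y * Real.sqrt 2 * q ^ 2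

/-- `τ_16(y, q)`: the coefficient of `λ^16` in `τ(λ) = λ(λ³ − q)⁴S₁₁(λ; y)` (kit `factor_coeff.py`, job j303997). [cite: Stanley2012EC1, §4.1 Theorem 4.1.1; lane «pcv-sawmu» a-p2 g28 — own computation] -/
def tauThree16 (y q : ℝ) : ℝ := (-1392 : ℝ) * q ^ 2 + (-6 : ℝ) * y ^ 2 + (-2 : ℝ) * y ^ 3 + (1 : ℝ) * y ^ 3 * Real.sqrt 2 + (-2784 : ℝ) * y * q ^ 2 + (-984 : ℝ) * Real.sqrt 2 * q ^ 2 + (-120 : ℝ) * y * q + (-96 : ℝ) * y ^ 2 * q + (3 : ℝ) * y ^ 2 * Real.sqrt 2 + (-1968 : ℝ) * y * Real.sqrt 2 * q ^ 2 + (-80 : ℝ) * y * Real.sqrt 2 * q + (-64 : ℝ) * y ^ 2 * Real.sqrt 2 * q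

/-- `τ_17(y, q)`: the coefficient of `λ^17` in `τ(λ) = λ(λ³ − q)⁴S₁₁(λ; y)` (kit `factor_coeff.py`, job j303997). [cite: Stanley2012EC1, §4.1 Theorem 4.1.1; lane «pcv-sawmu» a-p2 g28 — own computation] -/
def tauThree17 (y q : ℝ) : ℝ := (1 : ℝ) * y ^ 3 + (7 : ℝ) * y ^ 2 + (9504 : ℝ) * q ^ 2 + (160 : ℝ) * y ^ 2 * q + (480 : ℝ) * y * q + (4752 : ℝ) * y * q ^ 2 + (6720 : ℝ) * Real.sqrt 2 * q ^ 2 + (112 : ℝ) * y ^ 2 * Real.sqrt 2 * q + (336 : ℝ) * y * Real.sqrt 2 * q + (3360 : ℝ) * y * Real.sqrt 2 * q ^ 2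

/-- `τ_18(y, q)`: the coefficient of `λ^18` in `τ(λ) = λ(λ³ − q)⁴S₁₁(λ; y)` (kit `factor_coeff.py`, job j303997). [cite: Stanley2012EC1, §4.1 Theorem 4.1.1; lane «pcv-sawmu» a-p2 g28 — own computation] -/
def tauThree18 (y q : ℝ) : ℝ := (-16224 : ℝ) * q ^ 2 + (-272 : ℝ) * q + (-10 : ℝ) * y ^ 2 + (-4 : ℝ) * y + (-11472 : ℝ) * Real.sqrt 2 * q ^ 2 + (-1088 : ℝ) * y * q + (-192 : ℝ) * Real.sqrt 2 * q + (-5 : ℝ) * y ^ 2 * Real.sqrt 2 + (-2 : ℝ) * y * Real.sqrt 2 + (-768 : ℝ) * y * Real.sqrt 2 * q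

/-- `τ_19(y, q)`: the coefficient of `λ^19` in `τ(λ) = λ(λ³ − q)⁴S₁₁(λ; y)` (kit `factor_coeff.py`, job j303997). [cite: Stanley2012EC1, §4.1 Theorem 4.1.1; lane «pcv-sawmu» a-p2 g28 — own computation] -/
def tauThree19 (y q : ℝ) : ℝ := (24 : ℝ) * y ^ 2 + (30 : ℝ) * y + (928 : ℝ) * q + (16 : ℝ) * y ^ 2 * Real.sqrt 2 + (20 : ℝ) * y * Real.sqrt 2 + (656 : ℝ) * Real.sqrt 2 * q + (1856 : ℝ) * y * q + (1312 : ℝ) * y * Real.sqrt 2 * q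

/-- `τ_20(y, q)`: the coefficient of `λ^20` in `τ(λ) = λ(λ³ − q)⁴S₁₁(λ; y)` (kit `factor_coeff.py`, job j303997). [cite: Stanley2012EC1, §4.1 Theorem 4.1.1; lane «pcv-sawmu» a-p2 g28 — own computation] -/
def tauThree20 (y q : ℝ) : ℝ := (-6336 : ℝ) * q + (-120 : ℝ) * y + (-40 : ℝ) * y ^ 2 + (-4480 : ℝ) * Real.sqrt 2 * q + (-3168 : ℝ) * y * q + (-84 : ℝ) * y * Real.sqrt 2 + (-28 : ℝ) * y ^ 2 * Real.sqrt 2 + (-2240 : ℝ) * y * Real.sqrt 2 * q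

/-- `τ_21(y, q)`: the coefficient of `λ^21` in `τ(λ) = λ(λ³ − q)⁴S₁₁(λ; y)` (kit `factor_coeff.py`, job j303997). [cite: Stanley2012EC1, §4.1 Theorem 4.1.1; lane «pcv-sawmu» a-p2 g28 — own computation] -/
def tauThree21 (y q : ℝ) : ℝ := (68 : ℝ) + (48 : ℝ) * Real.sqrt 2 + (272 : ℝ) * y + (10816 : ℝ) * q + (192 : ℝ) * y * Real.sqrt 2 + (7648 : ℝ) * Real.sqrt 2 * q

/-- `τ_22(y, q)`: the coefficient of `λ^22` in `τ(λ) = λ(λ³ − q)⁴S₁₁(λ; y)` (kit `factor_coeff.py`, job j303997). [cite: Stanley2012EC1, §4.1 Theorem 4.1.1; lane «pcv-sawmu» a-p2 g28 — own computation] -/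
def tauThree22 (y _q : ℝ) : ℝ := (-232 : ℝ) + (-464 : ℝ) * y + (-164 : ℝ) * Real.sqrt 2 + (-328 : ℝ) * y * Real.sqrt 2

/-- `τ_23(y, q)`: the coefficient of `λ^23` in `τ(λ) = λ(λ³ − q)⁴S₁₁(λ; y)` (kit `factor_coeff.py`, job j303997). [cite: Stanley2012EC1, §4.1 Theorem 4.1.1; lane «pcv-sawmu» a-p2 g28 — own computation] -/
def tauThree23 (y _q : ℝ) : ℝ := (1584 : ℝ) + (792 : ℝ) * y + (1120 : ℝ) * Real.sqrt 2 + (560 : ℝ) * y * Real.sqrt 2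

/-- `τ_24(y, q)`: the coefficient of `λ^24` in `τ(λ) = λ(λ³ − q)⁴S₁₁(λ; y)` (kit `factor_coeff.py`, job j303997). [cite: Stanley2012EC1, §4.1 Theorem 4.1.1; lane «pcv-sawmu» a-p2 g28 — own computation] -/
def tauThree24 (_y _q : ℝ) : ℝ := (-2704 : ℝ) + (-1912 : ℝ) * Real.sqrt 2

/-- ★ The coefficients `τ_r(y, q)` (`r = 0,…,24`, else `0`) of the annihilating polynomial `τ(λ) := λ·(λ³ − q)⁴·S₁₁(λ; y) = Σ_r τ_r λ^r` — explicit
polynomials in `y`, `√2`, `q` (210 monomials in all).  With `q = x⁶y` this is `b₁₀·det P(λ)` for the width-three hat symbol `P` (`b₁₀ = −2704 − 1912√2`), i.e.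
`b₁₀` times the characteristic polynomial of the companion matrix `𝔾₃(y)` — the natural annihilator of the hat bridge sums. [cite: Stanley2012EC1, §4.1 Theorem 4.1.1; lane «pcv-sawmu» a-p2 g28 — own computation] -/
def tauThree (y q : ℝ) : ℕ → ℝ
  | 0 => tauThree0 y q
  | 1 => tauThree1 y q
  | 2 => tauThree2 y q
  | 3 => tauThree3 y q
  | 4 => tauThree4 y q
  | 5 => tauThree5 y q
  | 6 => tauThree6 y q
  | 7 => tauThree7 y q
  | 8 => tauThree8 y q
  | 9 => tauThree9 y q
  | 10 => tauThree10 y q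
  | 11 => tauThree11 y q
  | 12 => tauThree12 y q
  | 13 => tauThree13 y q
  | 14 => tauThree14 y q
  | 15 => tauThree15 y q
  | 16 => tauThree16 y q
  | 17 => tauThree17 y q
  | 18 => tauThree18 y q
  | 19 => tauThree19 y q
  | 20 => tauThree20 y q
  | 21 => tauThree21 y q
  | 22 => tauThree22 y q
  | 23 => tauThree23 y q
  | 24 => tauThree24 y q
  | _ => 0
/-- ★ **`τ` is the product `λ(λ³ − q)⁴·S₁₁(λ; y)`** with `S₁₁(λ; y) = (λ − 1)R₁₀(λ; y) + S₁₁(1; y)` of «WIDTH-THREE HAT SPECTRAL CERTIFICATE» — an identity of polynomial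
functions of a complex `z`, for every real `y, q` (pure `ring`). [cite: Stanley2012EC1, §4.1 Theorem 4.1.1; lane «pcv-sawmu» a-p2 g28 — own computation] -/
theorem tauThree_eval (y q : ℝ) (z : ℂ) :
    ∑ r ∈ range 25, ((tauThree y q r : ℝ) : ℂ) * z ^ r =
      z * (z ^ 3 - (q : ℂ)) ^ 4 * ((z - 1) * rTenEvalC y z + ((sElevenOne y : ℝ) : ℂ)) := by
  simp only [Finset.sum_range_succ, Finset.sum_range_zero, zero_add, rTenEvalC]
  simp only [tauThree, tauThree0, tauThree1, tauThree2, tauThree3, tauThree4, tauThree5, tauThree6, tauThree7, tauThree8, tauThree9, tauThree10, tauThree11, tauThree12, tauThree13, tauThree14, tauThree15, tauThree16, tauThree17, tauThree18, tauThree19, tauThree20, tauThree21, tauThree22, tauThree23, tauThree24, rTenCoeff, rTenA, rTenB, sElevenOne]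
  push_cast
  ring

/-! ## §2 The monic factor `Q(λ) = λ(λ³ − q₃)⁴R₁₀(λ; y₃)/b₁₀` and its roots -/

/-- `b₁₀ = −2704 − 1912√2`, the leading coefficient of `R₁₀` and of `τ` (plumbing). [cite: Stanley2012EC1, §4.1; lane plumbing] -/
def bTenThree : ℝ := -2704 - 1912 * Real.sqrt 2

/-- `b₁₀ < 0`, in particular `b₁₀ ≠ 0` (plumbing). [cite: Stanley2012EC1, §4.1; lane plumbing] -/
theorem bTenThree_neg : bTenThree < 0 := by
  have : 0 ≤ Real.sqrt 2 := Real.sqrt_nonneg 2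
  unfold bTenThree; linarith

/-- `rTenCoeff y 10 = b₁₀` for every `y` (plumbing). [cite: Stanley2012EC1, §4.1; lane plumbing] -/
theorem rTenCoeff_ten (y : ℝ) : rTenCoeff y 10 = bTenThree := by
  simp only [rTenCoeff, rTenA, rTenB, bTenThree]; ring

/-- The normalised degree-ten factor `R₁₀(λ; y)/b₁₀` as a complex polynomial: `X^{10} + Σ_{j<10} (b_j/b₁₀) X^j` (plumbing). [cite: Stanley2012EC1, §4.1; lane plumbing] -/
def rTenMonicPoly (y : ℝ) : ℂ[X] := X ^ 10 + ∑ j ∈ range 10, C (((rTenCoeff y j / bTenThree : ℝ) : ℂ)) * X ^ j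

/-- `rTenMonicPoly` is monic of degree `10` (plumbing). [cite: Stanley2012EC1, §4.1; lane plumbing] -/
theorem rTenMonicPoly_monic (y : ℝ) : (rTenMonicPoly y).Monic ∧ (rTenMonicPoly y).natDegree = 10 := by
  have hdeg : (∑ j ∈ range 10, C (((rTenCoeff y j / bTenThree : ℝ) : ℂ)) * X ^ j).degree < 10 := by
    refine lt_of_le_of_lt (degree_sum_le _ _) ?_
    refine (Finset.sup_lt_iff (by exact WithBot.bot_lt_coe 10)).2 fun j hj => ?_
    rw [Finset.mem_range] at hj
    exact lt_of_le_of_lt (degree_C_mul_X_pow_le j _) (by exact_mod_cast hj)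
  refine ⟨monic_X_pow_add hdeg, ?_⟩
  rw [rTenMonicPoly, natDegree_add_eq_left_of_degree_lt (by rw [degree_X_pow]; exact hdeg), natDegree_X_pow]

/-- Evaluation: `b₁₀ · (rTenMonicPoly y).eval z = rTenEvalC y z` (plumbing). [cite: Stanley2012EC1, §4.1; lane plumbing] -/
theorem rTenMonicPoly_eval (y : ℝ) (z : ℂ) : ((bTenThree : ℝ) : ℂ) * (rTenMonicPoly y).eval z = rTenEvalC y z := by
  have hb : ((bTenThree : ℝ) : ℂ) ≠ 0 := by exact_mod_cast bTenThree_neg.ne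
  have h10 := rTenCoeff_ten y
  simp only [rTenMonicPoly, rTenEvalC, eval_add, eval_pow, eval_X, eval_mul, eval_C, Finset.sum_range_succ, Finset.sum_range_zero,
    zero_add, h10]
  push_cast
  field_simp
  ring

/-- ★ **The monic annihilator factor** `Q(λ) := λ·(λ³ − q₃)⁴·(R₁₀(λ; y₃)/b₁₀)` (complex polynomial, `q₃ = x⁶y₃`): monic of degree `23`.
[cite: Stanley2012EC1, §4.1 Theorem 4.1.1; lane «pcv-sawmu» a-p2 g28] -/
def qMonicThree : ℂ[X] :=
  X * (X ^ 3 - C (((hexCriticalFugacity ^ 6 * stripYT 3 : ℝ)) : ℂ)) ^ 4 * rTenMonicPoly (stripYT 3)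

/-- `qMonicThree` is monic of degree `23` (plumbing). [cite: Stanley2012EC1, §4.1; lane plumbing] -/
theorem qMonicThree_monic : qMonicThree.Monic ∧ qMonicThree.natDegree = 23 := by
  obtain ⟨hR, hRdeg⟩ := rTenMonicPoly_monic (stripYT 3)
  have hX3 : (X ^ 3 - C (((hexCriticalFugacity ^ 6 * stripYT 3 : ℝ)) : ℂ)).Monic := monic_X_pow_sub_C _ (by norm_num)
  have hX3deg : (X ^ 3 - C (((hexCriticalFugacity ^ 6 * stripYT 3 : ℝ)) : ℂ)).natDegree = 3 := natDegree_X_pow_sub_C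
  have hP : ((X ^ 3 - C (((hexCriticalFugacity ^ 6 * stripYT 3 : ℝ)) : ℂ)) ^ 4).Monic := hX3.pow 4
  have hPdeg : ((X ^ 3 - C (((hexCriticalFugacity ^ 6 * stripYT 3 : ℝ)) : ℂ)) ^ 4).natDegree = 12 := by rw [hX3.natDegree_pow, hX3deg]
  have hXP : (X * (X ^ 3 - C (((hexCriticalFugacity ^ 6 * stripYT 3 : ℝ)) : ℂ)) ^ 4).Monic := monic_X.mul hP
  refine ⟨hXP.mul hR, ?_⟩
  rw [qMonicThree, hXP.natDegree_mul hR, monic_X.natDegree_mul hP, natDegree_X, hPdeg, hRdeg]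

/-- Evaluation: `b₁₀ · Q(z) = z (z³ − q₃)⁴ R₁₀(z; y₃)` (plumbing). [cite: Stanley2012EC1, §4.1; lane plumbing] -/
theorem qMonicThree_eval (z : ℂ) :
    ((bTenThree : ℝ) : ℂ) * qMonicThree.eval z = z * (z ^ 3 - (((hexCriticalFugacity ^ 6 * stripYT 3 : ℝ)) : ℂ)) ^ 4 * rTenEvalC (stripYT 3) z := by
  rw [qMonicThree, eval_mul, eval_mul, eval_pow, eval_sub, eval_pow, eval_X, eval_C, ← rTenMonicPoly_eval (stripYT 3) z]
  ring

/-- `q₃ = x⁶y₃ ≤ 0.08` (crude window; plumbing). [cite: BeatonBousquetMelouDeGierDuminilCopinGuttmann2014, §3.2; lane plumbing] -/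
theorem qThree_le : hexCriticalFugacity ^ 6 * stripYT 3 ≤ 8 / 100 := by
  obtain ⟨hs1, -⟩ := sqrt_two_window9
  obtain ⟨-, hy⟩ := stripYT_three_bounds
  have hx2 : hexCriticalFugacity ^ 2 = (2 - Real.sqrt 2) / 2 := xc_sq_eq_half
  have hx2le : hexCriticalFugacity ^ 2 ≤ 2928933 / 10000000 := by rw [hx2]; linarith
  have hx0 : 0 ≤ hexCriticalFugacity ^ 2 := sq_nonneg _
  have h6 : hexCriticalFugacity ^ 6 = (hexCriticalFugacity ^ 2) ^ 3 := by ring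
  have h6le : hexCriticalFugacity ^ 6 ≤ (2928933 / 10000000 : ℝ) ^ 3 := by rw [h6]; exact pow_le_pow_left₀ hx0 hx2le 3
  have hy0 : 0 ≤ stripYT 3 := (stripYT_pos (by norm_num)).le
  nlinarith [pow_nonneg hx0 3]

/-- ★★ **Every root of `Q` lies in the closed disc of radius `0.97`**: the roots are `0`, the cube roots of `q₃` (modulus `q₃^{1/3} < 0.44`) and the roots of `R₁₀(y₃; ·)`
(modulus `< 0.97` by «WIDTH-THREE HAT SPECTRAL CERTIFICATE»). [cite: Stanley2012EC1, §4.1 Theorem 4.1.1 (iii); lane «pcv-sawmu» a-p2 g28 — own] -/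
theorem qMonicThree_root_norm_le {z : ℂ} (hz : qMonicThree.IsRoot z) : ‖z‖ ≤ 97 / 100 := by
  have hb : ((bTenThree : ℝ) : ℂ) ≠ 0 := by exact_mod_cast bTenThree_neg.ne
  rw [IsRoot.def] at hz
  have hz' : z * (z ^ 3 - (((hexCriticalFugacity ^ 6 * stripYT 3 : ℝ)) : ℂ)) ^ 4 * rTenEvalC (stripYT 3) z = 0 := by
    rw [← qMonicThree_eval, hz, mul_zero]
  rcases mul_eq_zero.1 hz' with h | hR
  · rcases mul_eq_zero.1 h with h0 | h3
    · rw [h0, norm_zero]; norm_num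
    · -- z³ = q₃
      have h3' : z ^ 3 = (((hexCriticalFugacity ^ 6 * stripYT 3 : ℝ)) : ℂ) := by
        have := pow_eq_zero_iff (n := 4) (by norm_num) |>.1 h3
        exact sub_eq_zero.1 this
      have hn : ‖z‖ ^ 3 = hexCriticalFugacity ^ 6 * stripYT 3 := by
        rw [← norm_pow, h3', Complex.norm_real, Real.norm_eq_abs, abs_of_nonneg]
        exact mul_nonneg (pow_nonneg hexCriticalFugacity_pos_lt_one.1.le _) (stripYT_pos (by norm_num)).le
      by_contra hge
      push Not at hge
      have h97 : (97 / 100 : ℝ) ^ 3 ≤ ‖z‖ ^ 3 := pow_le_pow_left₀ (by norm_num) hge.le 3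
      have := qThree_le
      nlinarith
  · -- R₁₀(z) = 0
    exact (rTen_root_norm_lt hR).le

/-! ## §3 The annihilating polynomial factors as `τ = b₁₀·(X − 1)·Q` -/

/-- The annihilating polynomial `τ(X)` at `(y₃, q₃)` as a complex polynomial (plumbing). [cite: Stanley2012EC1, §4.1; lane plumbing] -/
def tauPolyThree : ℂ[X] := ∑ r ∈ range 25, C ((tauThree (stripYT 3) (hexCriticalFugacity ^ 6 * stripYT 3) r : ℝ) : ℂ) * X ^ r

/-- Coefficients of `tauPolyThree` (plumbing). [cite: Stanley2012EC1, §4.1; lane plumbing] -/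
theorem tauPolyThree_coeff (r : ℕ) (hr : r < 25) :
    tauPolyThree.coeff r = ((tauThree (stripYT 3) (hexCriticalFugacity ^ 6 * stripYT 3) r : ℝ) : ℂ) := by
  rw [tauPolyThree, finsetSum_coeff]
  simp only [coeff_C_mul_X_pow]
  rw [Finset.sum_eq_single r]
  · simp
  · intro j _ hj; simp [Ne.symm hj]
  · intro h; exact absurd (Finset.mem_range.2 hr) h

/-- ★★ **`τ = b₁₀·(X − 1)·Q` as complex polynomials** (from `tauThree_eval`, `S₁₁(1; y₃) = 0` and `Polynomial.funext`). [cite: Stanley2012EC1, §4.1 Theorem 4.1.1; lane «pcv-sawmu» a-p2 g28 — own] -/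
theorem tauPolyThree_eq : tauPolyThree = C ((bTenThree : ℝ) : ℂ) * ((X - C 1) * qMonicThree) := by
  have hb : ((bTenThree : ℝ) : ℂ) ≠ 0 := by exact_mod_cast bTenThree_neg.ne
  apply Polynomial.funext
  intro z
  rw [tauPolyThree, eval_finsetSum]
  simp only [eval_mul, eval_C, eval_pow, eval_X, eval_sub]
  rw [tauThree_eval, sElevenOne_stripYT_three, show ((bTenThree : ℝ) : ℂ) * ((z - 1) * qMonicThree.eval z)
    = (z - 1) * (((bTenThree : ℝ) : ℂ) * qMonicThree.eval z) by ring, qMonicThree_eval]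
  push_cast
  ring

/-! ## §4 From the annihilator to geometric convergence -/

/-- Coefficient bookkeeping: `Σ_{j<24} Q_j d_{n+1+j} − Σ_{j<24} Q_j d_{n+j} = Σ_{r<25} ((X − 1)Q)_r · d_{n+r}` for `deg Q = 23` (plumbing).
[cite: Stanley2012EC1, §4.1 Theorem 4.1.1; lane plumbing] -/
theorem sum_coeff_X_sub_one_mul (Q : ℂ[X]) (hQ : Q.natDegree = 23) (d : ℕ → ℂ) (n : ℕ) :
    ∑ j ∈ range 24, Q.coeff j * d (n + 1 + j) - ∑ j ∈ range 24, Q.coeff j * d (n + j) =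
      ∑ r ∈ range 25, ((X - C 1) * Q).coeff r * d (n + r) := by
  have hdeg : Q.coeff 24 = 0 := coeff_eq_zero_of_natDegree_lt (by omega)
  have hc0 : ((X - C 1) * Q).coeff 0 = -(1 * Q.coeff 0) := by
    rw [sub_mul, coeff_sub, coeff_X_mul_zero, coeff_C_mul]; ring
  have hcs : ∀ j, ((X - C 1) * Q).coeff (j + 1) = Q.coeff j - 1 * Q.coeff (j + 1) := fun j => by
    rw [sub_mul, coeff_sub, coeff_X_mul, coeff_C_mul]
  conv_rhs => rw [Finset.sum_range_succ', hc0]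
  simp only [hcs]
  simp only [sub_mul, Finset.sum_sub_distrib]
  have hshift : ∑ j ∈ range 24, 1 * Q.coeff (j + 1) * d (n + (j + 1)) + 1 * Q.coeff 0 * d (n + 0)
      = ∑ j ∈ range 24, Q.coeff j * d (n + j) := by
    have e : ∑ j ∈ range (24 + 1), 1 * Q.coeff j * d (n + j) = ∑ j ∈ range 24, Q.coeff j * d (n + j) := by
      rw [Finset.sum_range_succ, hdeg]
      simp only [mul_zero, zero_mul, add_zero]
      exact Finset.sum_congr rfl fun j _ => by ring
    rw [← e, Finset.sum_range_succ' (fun j => 1 * Q.coeff j * d (n + j))]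
  have hmain : ∑ j ∈ range 24, Q.coeff j * d (n + (j + 1)) = ∑ j ∈ range 24, Q.coeff j * d (n + 1 + j) :=
    Finset.sum_congr rfl fun j _ => by rw [show n + (j + 1) = n + 1 + j by ring]
  rw [hmain]
  linear_combination hshift

/-- ★★★ **CONVERGENCE CRITERION FOR THE WIDTH-THREE HAT SUMS (conditional on the annihilator).**  Suppose the hat bridge sums of the critical width-three
strip satisfy, entrywise, the order-`24` scalar recurrence with the explicit polynomial `τ = λ(λ³ − q₃)⁴S₁₁(λ; y₃)` (= `b₁₀·det P(λ)`, the natural output of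
the adjugate identity `adj P · P = det P · 1` applied to «WIDTH-THREE HAT RECURSION» — the ONE remaining car of the programme): `Σ_{r ≤ 24} τ_r D̂(n+1+r)_{ab} = 0`
for all `n`.  THEN every hat bridge sum converges GEOMETRICALLY: there are a real matrix `A` and a constant `C` with
`|D̂(n+1)_{ab} − A_{ab}| ≤ C·(n+1)^{23}·(0.97)^n` for all `a, b, n`.
Ingredients: the factorisation `τ = b₁₀(X − 1)Q` (§3), the root bound for `Q` (§2: «SPECTRAL CERTIFICATE» + the cube roots of `q₃`), and
`Literature.Analysis.exists_norm_sub_le_of_linearRecurrence_one` of «LINEAR RECURRENCE DEFLATION — GENERAL ORDER».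
[cite: Stanley2012EC1, §4.1 Theorem 4.1.1 (iii); Feller1968, XIII.3; lane «pcv-sawmu» a-p2 g28 — own result, conditional as stated] -/
theorem hatD_three_geometric_of_annihilator
    (hann : ∀ (a b : Fin (2 * 3)) (n : ℕ),
      ∑ r ∈ range 25, tauThree (stripYT 3) (hexCriticalFugacity ^ 6 * stripYT 3) r * hatD 3 (stripYT 3) (n + 1 + r) a b = 0) :
    ∃ A : Matrix (Fin (2 * 3)) (Fin (2 * 3)) ℝ, ∃ C : ℝ, ∀ (a b : Fin (2 * 3)) (n : ℕ),
      |hatD 3 (stripYT 3) (n + 1) a b - A a b| ≤ C * ((n : ℝ) + 1) ^ 23 * (97 / 100 : ℝ) ^ n := by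
  obtain ⟨hQm, hQdeg⟩ := qMonicThree_monic
  have hb : ((bTenThree : ℝ) : ℂ) ≠ 0 := by exact_mod_cast bTenThree_neg.ne
  -- for every pair of levels: car 5's convergence theorem
  have key : ∀ a b : Fin (2 * 3), ∃ L : ℂ, ∃ C' : ℝ, 0 ≤ C' ∧ ∀ n : ℕ,
      ‖((hatD 3 (stripYT 3) (n + 1) a b : ℝ) : ℂ) - L‖ ≤ C' * ((n : ℝ) + 1) ^ qMonicThree.natDegree * (97 / 100 : ℝ) ^ n := by
    intro a b
    set d : ℕ → ℂ := fun m => ((hatD 3 (stripYT 3) (m + 1) a b : ℝ) : ℂ) with hd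
    have hrec : ∀ n : ℕ, ∑ j ∈ range (qMonicThree.natDegree + 1), qMonicThree.coeff j * (d (n + 1 + j) - d (n + j)) = 0 := by
      intro n
      rw [hQdeg]
      have e : ∑ j ∈ range (23 + 1), qMonicThree.coeff j * (d (n + 1 + j) - d (n + j))
          = ∑ j ∈ range 24, qMonicThree.coeff j * d (n + 1 + j) - ∑ j ∈ range 24, qMonicThree.coeff j * d (n + j) := by
        rw [← Finset.sum_sub_distrib]; exact Finset.sum_congr rfl fun j _ => by ring
      rw [e, sum_coeff_X_sub_one_mul qMonicThree hQdeg d n]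
      -- `Σ_r τ_r d_{n+r} = b₁₀ · Σ_r ((X−1)Q)_r d_{n+r}` and the former vanishes
      have h1 : ∑ r ∈ range 25, tauPolyThree.coeff r * d (n + r) = 0 := by
        have h := hann a b n
        have : ∑ r ∈ range 25, tauPolyThree.coeff r * d (n + r) =
            ((∑ r ∈ range 25, tauThree (stripYT 3) (hexCriticalFugacity ^ 6 * stripYT 3) r * hatD 3 (stripYT 3) (n + 1 + r) a b : ℝ) : ℂ) := by
          push_cast
          refine Finset.sum_congr rfl fun r hr => ?_
          rw [tauPolyThree_coeff r (Finset.mem_range.1 hr), hd]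
          simp only [show n + r + 1 = n + 1 + r by ring]
        rw [this, h]; simp
      have h2 : ∀ r, tauPolyThree.coeff r = ((bTenThree : ℝ) : ℂ) * ((X - C 1) * qMonicThree).coeff r := fun r => by
        rw [tauPolyThree_eq, coeff_C_mul]
      simp only [h2, mul_assoc] at h1
      rw [← Finset.mul_sum] at h1
      rcases mul_eq_zero.1 h1 with h' | h'
      · exact absurd h' hb
      · exact h'
    exact Literature.Analysis.exists_norm_sub_le_of_linearRecurrence_one hQm (by norm_num) (by norm_num) (fun z hz => qMonicThree_root_norm_le hz) hrec
  choose L C' hC' hbound using key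
  refine ⟨Matrix.of fun a b => (L a b).re, ∑ a, ∑ b, C' a b, fun a b n => ?_⟩
  have h := hbound a b n
  rw [hQdeg] at h
  have hC : C' a b ≤ ∑ a, ∑ b, C' a b := by
    calc C' a b ≤ ∑ b', C' a b' := Finset.single_le_sum (fun b' _ => hC' a b') (Finset.mem_univ b)
      _ ≤ ∑ a', ∑ b', C' a' b' := Finset.single_le_sum (fun a' _ => Finset.sum_nonneg fun b' _ => hC' a' b') (Finset.mem_univ a)
  have hpos : 0 ≤ ((n : ℝ) + 1) ^ 23 * (97 / 100 : ℝ) ^ n := by positivity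
  calc |hatD 3 (stripYT 3) (n + 1) a b - (Matrix.of fun a b => (L a b).re) a b|
      = |((((hatD 3 (stripYT 3) (n + 1) a b : ℝ) : ℂ) - L a b).re)| := by simp [Matrix.of_apply]
    _ ≤ ‖((hatD 3 (stripYT 3) (n + 1) a b : ℝ) : ℂ) - L a b‖ := Complex.abs_re_le_norm _
    _ ≤ C' a b * ((n : ℝ) + 1) ^ 23 * (97 / 100 : ℝ) ^ n := h
    _ ≤ (∑ a, ∑ b, C' a b) * ((n : ℝ) + 1) ^ 23 * (97 / 100 : ℝ) ^ n := by
        rw [mul_assoc, mul_assoc]; exact mul_le_mul_of_nonneg_right hC hpos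

end W3

end HV

end Literature.Probability.RandomPlanarGeometry.SAW
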